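/-
Copyright (c) 2026. All rights reserved.
Released under Apache 2.0 license as described in the file LICENSE.
Authors: HodgeCM publication cell (pub-hodgecm), GR lane, seat GR-2 (`pub-hodgecm-own-hyp34`).
-/
import Literature.NumberTheory.GelbartRogawski1991.Prop311PrintedSymplecticFrame
import Literature.NumberTheory.GelbartRogawski1991.Prop311PrintedUnitaryJunction
import Literature.NumberTheory.Automorphic.UnitaryGroupSymplecticRationalPoints
import Literature.NumberTheory.Weil1964.AdelicMetaplecticGenerators
import HarnessLib

/-!
# [GelbartRogawski1991, §3.1, Prop. 3.1.1]: the PRINTED `Sp_F(W) ⊆ Sp_𝐀(W)` in a `Φ`-orthogonal `E`-frame —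
# `frameSp` carries `Sp_F(W)` onto the RATIONAL POINTS `Sp_{2N}(F) ↪ Sp(𝐀ᴺ × 𝐀ᴺ)` of the tree (`Weil1964.ratSp`)

Topic `NumberTheory/GelbartRogawski1991`; namespace `Literature.NumberTheory.GelbartRogawski1991.Prop311`.
Definitions and proved lemmas only; nothing of [GelbartRogawski1991] is asserted; `Prop311AsPrinted` is untouched.

[GelbartRogawski1991, §3.1 p. 454 L35–36]: "*It is known ([We]) that `π` splits uniquely over the group of `F`-rational
points `Sp_F(W)`. We denote this splitting by `i`.*"  The statement-exact typing renders `Sp_F(W)` as `Prop311.ratSp F E V Φ`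
(the `F`-linear `φ`-isometries of `W = V`) inside `Sp_𝐀(W)` through `ratSpToAdelic : g₀ ↦ 1 ⊗ g₀`
(`Prop311PrintedCarriers`); the tree's splitting data (`UnitaryDualPair.splittingDatum`, `cmSplittingDatum`) record
`Sp_F(W)` as the range `spRat` of `Weil1964.ratSp F T_𝐀 _ = transportSp T_𝐀 ∘ mapHom (F → 𝐀) : Sp_{2N}(F) →* Sp(𝐀ᴺ × 𝐀ᴺ, β_T)`,
over which Weil's `r_F` (`ratSection`) is THE rational section.  The transport of a compatible splitting between the
printed datum and the tree's (`CompatibleSplittingInvariance.transport_of_unique`) needs an isomorphism `e₀` of these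
two "`Sp_F(W)`" lying over the isomorphism `frameSp b` of `Prop311PrintedSymplecticFrame`.  This file supplies it, for a
`Φ`-orthogonal `E`-basis `b` (`Φ(bᵢ, bⱼ) = 0`, `Φ(bᵢ, bᵢ) = fᵢ δ`), `T = diag(-2 d fᵢ)`:

* §1 the RATIONAL dictionary `φ(v, v') = alt (polar β_T) (ratFrame v, ratFrame v')` (`traceForm_eq_alt_polar`) and
  `ratFrameConj b : Sp_F(W) ≃* Sp(Fᴺ × Fᴺ, alt (polar β_T))` (`mem_ratSp_iff_ratFrameConj_mem`, `ratFrameSp`);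
* §2 `adelicFrame (1 ⊗ v) = (ratFrame v) ⊗ 1` and the EXTENSION property: `frameSp (1 ⊗ g₀)` restricts on `F`-rational
  vectors to `ratFrameConj g₀` (`frameConj_baseChange_apply_algebraMap`);
* §3 `isUnit_det_symplecticGram`; **`frameSp_ratSpToAdelic_eq`**: `frameSp (1 ⊗ g₀) = Weil1964.ratSp T_𝐀 (untransportSp (ratFrameConj g₀))`
  (rationality by extension, `SpTransport.eq_transportSp_mapHom_untransportSp`), hence
  **`map_frameSp_range_ratSpToAdelic`**: `frameSp b (Sp_F(W)) = (Weil1964.ratSp F T_𝐀 _).range` as subgroups, and the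
  isomorphism **`frameSpRat b : (ratSpToAdelic F E V Φ).range ≃* (Weil1964.ratSp F T_𝐀 _).range`** over `frameSp b`
  (`coe_frameSpRat`) — the `e₀`/`he₀` of `CompatibleSplittingInvariance`.

## References
* [GelbartRogawski1991] S. Gelbart, J. Rogawski, Invent. Math. 105 (1991) 445–472, §3.1 p. 454 L17–42, Prop. 3.1.1
  p. 455 L1–2.
* [Weil1964] A. Weil, Acta Math. 111 (1964), Chap. III n° 37 p. 188 (the rational symplectic group inside the adelic one).
-/

set_option autoImplicit false

noncomputable section

open NumberField
open scoped TensorProduct Matrix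
open Literature.NumberTheory.Automorphic
open Literature.NumberTheory.Automorphic.UnitaryGroup
open Literature.RepresentationTheory.HeisenbergGroup

namespace Literature.NumberTheory.GelbartRogawski1991

namespace Prop311

open QuadraticCoordinates

variable (F : Type) [Field F] [NumberField F]
variable (E : Type) [Field E] [NumberField E] [Algebra F E] [Algebra.IsQuadraticExtension F E]
variable (σ : E ≃ₐ[F] E) {δ : E} (hσδ : σ δ = -δ) (hδ : δ ≠ 0) {d : F} (hd : δ * δ = algebraMap F E d)
variable (V : Type) [AddCommGroup V] [Module F V] [Module E V] [IsScalarTower F E V]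
variable {n : ℕ} (b : Module.Basis (Fin n) E V)
variable (Φ : V →ₗ[F] V →ₗ[F] E) (f : Fin n → F)

/-! ## §1. The rational dictionary: `φ = alt (polar β_T) ∘ ratFrame` and `Sp_F(W) ≃* Sp(Fᴺ × Fᴺ, β_T)` -/

section Rational

omit [NumberField F] in
/-- `T = (-2d) · diag f`. [cite: GelbartRogawski1991, §3.1 p. 454 L40–42] -/
theorem symplecticGram_eq_smul : symplecticGram F d f = (-2 * d) • Matrix.diagonal f := by
  ext i j
  rw [symplecticGram, Matrix.smul_apply, smul_eq_mul]
  by_cases hij : i = j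
  · subst hij; rw [Matrix.diagonal_apply_eq, Matrix.diagonal_apply_eq]
  · rw [Matrix.diagonal_apply_ne _ hij, Matrix.diagonal_apply_ne _ hij, mul_zero]

/-- **`φ(v, v') = alt (polar β_T) (ratFrame v, ratFrame v')`** — the RATIONAL form of `adelicTraceForm_eq_alt_polar`:
print's `φ = Tr_{E/F}(Φ)` on `W = V` is the alternating form of the polarised pairing `β_T`, `T = diag(-2 d fᵢ)`, in the
rational frame (through the tree's `im_hermForm_map` over `(F, E)`). [cite: GelbartRogawski1991, §3.1 p. 454 L17, L40–42] -/
theorem traceForm_eq_alt_polar (hΦ₁ : ∀ (e : E) (x y : V), Φ (e • x) y = e * Φ x y)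
    (hΦ₂ : ∀ (e : E) (x y : V), Φ x (e • y) = Φ x y * σ e) (hb : ∀ i j, i ≠ j → Φ (b i) (b j) = 0)
    (hf : ∀ i, Φ (b i) (b i) = algebraMap F E (f i) * δ) (v v' : V) :
    traceForm F E V Φ v v' =
      alt (polar (Matrix.toLinearMap₂' F (symplecticGram F d f))) (ratFrame F E σ hσδ hδ hd V b v)
        (ratFrame F E σ hσδ hδ hd V b v') := by
  have hF := isQuadraticCoordinates_rat E σ hσδ hδ hd
  have hD : (Matrix.diagonal f).IsSymm := Matrix.isSymm_diagonal f
  apply (algebraMap F E).injective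
  have hherm : hermForm (σ : E →+* E) (gramMatrix F E V b Φ) (b.repr v') (b.repr v) =
      δ * hermForm (σ : E →+* E) ((Matrix.diagonal f).map (algebraMap F E)) (b.repr v') (b.repr v) := by
    rw [gramMatrix_eq_of_orthogonal F E V b Φ f hb hf, hermForm_apply, hermForm_apply, Matrix.smul_mulVec,
      dotProduct_smul, smul_eq_mul]
  -- `Tr(δ z) = 2 d · im z` for the conjugation `σ` (the tree's `trace_delta_mul`, read for the `AlgEquiv`)
  have htr : ∀ z : E, δ * z + σ (δ * z) =
      algebraMap F E (2 * d * im (quadraticRatCoords E (not_mem_range_algebraMap_of_apply_eq_neg E σ hσδ hδ)).toAddEquiv z) :=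
    fun z => hF.trace_delta_mul (σ := (σ : E →+* E)) (fun a => σ.commutes a) hσδ z
  rw [traceForm_apply, algebraMap_trace_eq_add F E σ hσδ hδ, apply_eq_hermForm F E σ V b Φ hΦ₁ hΦ₂, hherm, htr,
    hF.im_hermForm_map (Fin n) hD (σ := (σ : E →+* E)) (fun a => σ.commutes a) hσδ,
    ← ratFrame_apply F E σ hσδ hδ hd V b v', ← ratFrame_apply F E σ hσδ hδ hd V b v,
    symplecticGram_eq_smul, alt_polar_toLinearMap₂'_smul, alt_apply, alt_apply]
  congr 1
  ring

/-- the rational frame conjugate `ratFrame b ∘ g₀ ∘ (ratFrame b)⁻¹` of an `F`-linear automorphism of `W = V`.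
[cite: GelbartRogawski1991, §3.1 p. 454 L41–42] -/
def ratFrameConj (g₀ : V ≃ₗ[F] V) : ((Fin n → F) × (Fin n → F)) ≃ₗ[F] ((Fin n → F) × (Fin n → F)) :=
  (ratFrame F E σ hσδ hδ hd V b).symm.trans (g₀.trans (ratFrame F E σ hσδ hδ hd V b))

/-- formula: `ratFrameConj b g₀ (ratFrame v) = ratFrame (g₀ v)`. [cite: GelbartRogawski1991, §3.1 p. 454 L41–42] -/
@[simp] theorem ratFrameConj_apply_ratFrame (g₀ : V ≃ₗ[F] V) (v : V) :
    ratFrameConj F E σ hσδ hδ hd V b g₀ (ratFrame F E σ hσδ hδ hd V b v) = ratFrame F E σ hσδ hδ hd V b (g₀ v) := by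
  rw [ratFrameConj, LinearEquiv.trans_apply, LinearEquiv.trans_apply, LinearEquiv.symm_apply_apply]

/-- `ratFrameConj` is multiplicative. [cite: GelbartRogawski1991, §3.1 p. 454 L41–42] -/
theorem ratFrameConj_mul (g₀ g₀' : V ≃ₗ[F] V) :
    ratFrameConj F E σ hσδ hδ hd V b (g₀ * g₀') =
      ratFrameConj F E σ hσδ hδ hd V b g₀ * ratFrameConj F E σ hσδ hδ hd V b g₀' := by
  refine LinearEquiv.ext fun p => ?_
  obtain ⟨v, rfl⟩ : ∃ v, ratFrame F E σ hσδ hδ hd V b v = p :=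
    ⟨(ratFrame F E σ hσδ hδ hd V b).symm p, (ratFrame F E σ hσδ hδ hd V b).apply_symm_apply p⟩
  rw [LinearEquiv.mul_apply, ratFrameConj_apply_ratFrame, ratFrameConj_apply_ratFrame, ratFrameConj_apply_ratFrame,
    LinearEquiv.mul_apply]

/-- **`g₀ ∈ Sp_F(W)` iff `ratFrame ∘ g₀ ∘ ratFrame⁻¹ ∈ Sp(Fᴺ × Fᴺ, alt (polar β_T))`** (orthogonal frame).
[cite: GelbartRogawski1991, §3.1 p. 454 L35–36, L40–42] -/
theorem mem_ratSp_iff_ratFrameConj_mem (hΦ₁ : ∀ (e : E) (x y : V), Φ (e • x) y = e * Φ x y)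
    (hΦ₂ : ∀ (e : E) (x y : V), Φ x (e • y) = Φ x y * σ e) (hb : ∀ i j, i ≠ j → Φ (b i) (b j) = 0)
    (hf : ∀ i, Φ (b i) (b i) = algebraMap F E (f i) * δ) (g₀ : V ≃ₗ[F] V) :
    g₀ ∈ ratSp F E V Φ ↔
      ratFrameConj F E σ hσδ hδ hd V b g₀ ∈ symplecticGroup (polar (Matrix.toLinearMap₂' F (symplecticGram F d f))) := by
  show g₀ ∈ Heisenberg.PseudoSymplectic.isometries (traceForm F E V Φ) ↔
    ratFrameConj F E σ hσδ hδ hd V b g₀ ∈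
      Heisenberg.PseudoSymplectic.isometries (alt (polar (Matrix.toLinearMap₂' F (symplecticGram F d f))))
  rw [Heisenberg.PseudoSymplectic.mem_isometries, Heisenberg.PseudoSymplectic.mem_isometries]
  constructor
  · intro hg p q
    obtain ⟨x, rfl⟩ : ∃ x, ratFrame F E σ hσδ hδ hd V b x = p :=
      ⟨(ratFrame F E σ hσδ hδ hd V b).symm p, (ratFrame F E σ hσδ hδ hd V b).apply_symm_apply p⟩
    obtain ⟨y, rfl⟩ : ∃ y, ratFrame F E σ hσδ hδ hd V b y = q :=
      ⟨(ratFrame F E σ hσδ hδ hd V b).symm q, (ratFrame F E σ hσδ hδ hd V b).apply_symm_apply q⟩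
    rw [ratFrameConj_apply_ratFrame, ratFrameConj_apply_ratFrame,
      ← traceForm_eq_alt_polar F E σ hσδ hδ hd V b Φ f hΦ₁ hΦ₂ hb hf,
      ← traceForm_eq_alt_polar F E σ hσδ hδ hd V b Φ f hΦ₁ hΦ₂ hb hf, hg]
  · intro hg x y
    rw [traceForm_eq_alt_polar F E σ hσδ hδ hd V b Φ f hΦ₁ hΦ₂ hb hf,
      traceForm_eq_alt_polar F E σ hσδ hδ hd V b Φ f hΦ₁ hΦ₂ hb hf, ← ratFrameConj_apply_ratFrame,
      ← ratFrameConj_apply_ratFrame, hg]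

/-- **`ratFrameSp b : Sp_F(W) →* Sp(Fᴺ × Fᴺ, alt (polar β_T))`**, `g₀ ↦ ratFrame ∘ g₀ ∘ ratFrame⁻¹`: print's `F`-rational
symplectic group in the rational frame. [cite: GelbartRogawski1991, §3.1 p. 454 L35–36, L40–42] -/
def ratFrameSp (hΦ₁ : ∀ (e : E) (x y : V), Φ (e • x) y = e * Φ x y)
    (hΦ₂ : ∀ (e : E) (x y : V), Φ x (e • y) = Φ x y * σ e) (hb : ∀ i j, i ≠ j → Φ (b i) (b j) = 0)
    (hf : ∀ i, Φ (b i) (b i) = algebraMap F E (f i) * δ) :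
    ratSp F E V Φ →* symplecticGroup (polar (Matrix.toLinearMap₂' F (symplecticGram F d f))) where
  toFun g₀ := ⟨ratFrameConj F E σ hσδ hδ hd V b g₀,
    (mem_ratSp_iff_ratFrameConj_mem F E σ hσδ hδ hd V b Φ f hΦ₁ hΦ₂ hb hf _).1 g₀.2⟩
  map_one' := Subtype.ext (LinearEquiv.ext fun p => by
    simp only [OneMemClass.coe_one, ratFrameConj, LinearEquiv.trans_apply, LinearEquiv.coe_one, id_eq,
      LinearEquiv.apply_symm_apply])
  map_mul' g₀ g₀' := Subtype.ext (ratFrameConj_mul F E σ hσδ hδ hd V b _ _)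

/-- `ratFrameSp b g₀` acts by `ratFrameConj b g₀`. [cite: GelbartRogawski1991, §3.1 p. 454 L35–36] -/
@[simp] theorem coe_ratFrameSp (hΦ₁ : ∀ (e : E) (x y : V), Φ (e • x) y = e * Φ x y)
    (hΦ₂ : ∀ (e : E) (x y : V), Φ x (e • y) = Φ x y * σ e) (hb : ∀ i j, i ≠ j → Φ (b i) (b j) = 0)
    (hf : ∀ i, Φ (b i) (b i) = algebraMap F E (f i) * δ) (g₀ : ratSp F E V Φ) :
    ((ratFrameSp F E σ hσδ hδ hd V b Φ f hΦ₁ hΦ₂ hb hf g₀ :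
        symplecticGroup (polar (Matrix.toLinearMap₂' F (symplecticGram F d f)))) :
          ((Fin n → F) × (Fin n → F)) ≃ₗ[F] ((Fin n → F) × (Fin n → F))) =
      ratFrameConj F E σ hσδ hδ hd V b g₀ :=
  rfl

end Rational

/-! ## §2. The adelic frame extends the rational one -/

section Extension

/-- **`adelicFrame b (1 ⊗ v) = (ratFrame b v) ⊗ 1`**: on `1 ⊗ W ⊂ W_𝐀` the adelic frame is the rational frame followed
by `F → 𝐀` coordinatewise. [cite: GelbartRogawski1991, §3.1 p. 454 L22, L41–42] -/
theorem adelicFrame_one_tmul (v : V) :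
    adelicFrame F E σ hσδ hδ hd V b (1 ⊗ₜ v) =
      (⇑(algebraMap F (AdeleRing (𝓞 F) F)) ∘ (ratFrame F E σ hσδ hδ hd V b v).1,
        ⇑(algebraMap F (AdeleRing (𝓞 F) F)) ∘ (ratFrame F E σ hσδ hδ hd V b v).2) := by
  rw [adelicFrame_tmul, ratFrame_apply]
  refine Prod.ext (funext fun i => ?_) (funext fun i => ?_) <;>
    simp only [reIm_apply_fst, reIm_apply_snd, frameCoordE_apply, map_one, one_mul, Function.comp_apply,
      adele_re_algebraMap F E σ hσδ hδ hd, adele_im_algebraMap F E σ hσδ hδ hd]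

/-- `F`-rational vectors of `𝐀ᴺ × 𝐀ᴺ` are frames of `1 ⊗ W`: `(p ⊗ 1) = adelicFrame b (1 ⊗ ratFrame⁻¹ p)`.
[cite: GelbartRogawski1991, §3.1 p. 454 L22, L41–42] -/
theorem algebraMap_comp_eq_adelicFrame (p : (Fin n → F) × (Fin n → F)) :
    ((⇑(algebraMap F (AdeleRing (𝓞 F) F)) ∘ p.1, ⇑(algebraMap F (AdeleRing (𝓞 F) F)) ∘ p.2) :
        (Fin n → AdeleRing (𝓞 F) F) × (Fin n → AdeleRing (𝓞 F) F)) =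
      adelicFrame F E σ hσδ hδ hd V b (1 ⊗ₜ (ratFrame F E σ hσδ hδ hd V b).symm p) := by
  rw [adelicFrame_one_tmul, LinearEquiv.apply_symm_apply]

/-- **EXTENSION**: the frame conjugate of `1 ⊗ g₀` restricts, on `F`-rational vectors, to the rational frame conjugate of
`g₀` (followed by `F → 𝐀`). [cite: GelbartRogawski1991, §3.1 p. 454 L35–36, L41–42] -/
theorem frameConj_baseChange_apply_algebraMap (g₀ : V ≃ₗ[F] V) (p : (Fin n → F) × (Fin n → F)) :
    frameConj F E σ hσδ hδ hd V b (g₀.baseChange F (AdeleRing (𝓞 F) F) V V)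
        (⇑(algebraMap F (AdeleRing (𝓞 F) F)) ∘ p.1, ⇑(algebraMap F (AdeleRing (𝓞 F) F)) ∘ p.2) =
      (⇑(algebraMap F (AdeleRing (𝓞 F) F)) ∘ (ratFrameConj F E σ hσδ hδ hd V b g₀ p).1,
        ⇑(algebraMap F (AdeleRing (𝓞 F) F)) ∘ (ratFrameConj F E σ hσδ hδ hd V b g₀ p).2) := by
  rw [algebraMap_comp_eq_adelicFrame F E σ hσδ hδ hd V b p, frameConj_apply_adelicFrame, LinearEquiv.baseChange_tmul,
    adelicFrame_one_tmul]
  rfl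

end Extension

/-! ## §3. `frameSp` carries `Sp_F(W)` onto the range of `Weil1964.ratSp` -/

section RationalPoints

/-- `T = diag(-2 d fᵢ)` is invertible when `d ≠ 0` and all `fᵢ ≠ 0` (i.e. `Φ` non-degenerate in the orthogonal frame).
[cite: GelbartRogawski1991, §3.1 p. 454 L17, L40–42] -/
theorem isUnit_det_symplecticGram (hd0 : d ≠ 0) (hf0 : ∀ i, f i ≠ 0) : IsUnit (symplecticGram F d f).det := by
  rw [symplecticGram, Matrix.det_diagonal, isUnit_iff_ne_zero, Finset.prod_ne_zero_iff]
  intro i _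
  exact mul_ne_zero (mul_ne_zero (neg_ne_zero.2 two_ne_zero) hd0) (hf0 i)

omit [NumberField F] [NumberField E] [Algebra.IsQuadraticExtension F E] in
include hd hδ in
/-- `d ≠ 0` (`δ² = d`, `δ ≠ 0`). [cite: GelbartRogawski1991, §1.1 p. 449 L26] -/
theorem d_ne_zero : d ≠ 0 := by
  intro h0
  rw [h0, map_zero, mul_self_eq_zero] at hd
  exact hδ hd

omit [NumberField E] [Algebra.IsQuadraticExtension F E] in
/-- invertibility base-changes to `𝐀`. [cite: GelbartRogawski1991, §3.1 p. 454 L22] -/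
theorem isUnit_det_symplecticGram_map (hT : IsUnit (symplecticGram F d f).det) :
    IsUnit ((symplecticGram F d f).map (algebraMap F (AdeleRing (𝓞 F) F))).det := by
  rw [← RingHom.mapMatrix_apply, ← RingHom.map_det]
  exact hT.map _

/-- **`frameSp (1 ⊗ g₀)` IS the tree's rational point `transportSp T_𝐀 (mapHom (F → 𝐀) (untransportSp T (ratFrameConj g₀)))`**
for `g₀ ∈ Sp_F(W)` (rationality by extension: both extend `ratFrameConj g₀` on `F`-rational vectors).
[cite: GelbartRogawski1991, §3.1 p. 454 L35–36; Weil1964, Chap. III n° 37 p. 188] -/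
theorem frameSp_ratSpToAdelic_eq (hΦ₁ : ∀ (e : E) (x y : V), Φ (e • x) y = e * Φ x y)
    (hΦ₂ : ∀ (e : E) (x y : V), Φ x (e • y) = Φ x y * σ e) (hb : ∀ i j, i ≠ j → Φ (b i) (b j) = 0)
    (hf : ∀ i, Φ (b i) (b i) = algebraMap F E (f i) * δ) (hT : IsUnit (symplecticGram F d f).det) (g₀ : ratSp F E V Φ) :
    frameSp F E σ hσδ hδ hd V b Φ f hΦ₁ hΦ₂ hb hf (ratSpToAdelic F E V Φ g₀) =
      SymplecticMatrix.transportSp ((symplecticGram F d f).map (algebraMap F (AdeleRing (𝓞 F) F)))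
        (isUnit_det_symplecticGram_map F f hT)
        (SymplecticMatrix.mapHom (algebraMap F (AdeleRing (𝓞 F) F))
          (SpTransport.untransportSp (symplecticGram F d f) hT (ratFrameSp F E σ hσδ hδ hd V b Φ f hΦ₁ hΦ₂ hb hf g₀))) :=
  SpTransport.eq_transportSp_mapHom_untransportSp (symplecticGram F d f) hT (algebraMap F (AdeleRing (𝓞 F) F)) _
    (isUnit_det_symplecticGram_map F f hT) rfl _ _ fun p => by
      rw [coe_frameSp, coe_ratSpToAdelic, coe_ratFrameSp, frameConj_baseChange_apply_algebraMap]

/-- hence **`frameSp (Sp_F(W)) ⊆ (Weil1964.ratSp F T_𝐀 _).range`**. [cite: GelbartRogawski1991, §3.1 p. 454 L35–36] -/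
theorem frameSp_ratSpToAdelic_mem_range (hΦ₁ : ∀ (e : E) (x y : V), Φ (e • x) y = e * Φ x y)
    (hΦ₂ : ∀ (e : E) (x y : V), Φ x (e • y) = Φ x y * σ e) (hb : ∀ i j, i ≠ j → Φ (b i) (b j) = 0)
    (hf : ∀ i, Φ (b i) (b i) = algebraMap F E (f i) * δ) (hT : IsUnit (symplecticGram F d f).det) (g₀ : ratSp F E V Φ) :
    frameSp F E σ hσδ hδ hd V b Φ f hΦ₁ hΦ₂ hb hf (ratSpToAdelic F E V Φ g₀) ∈
      (Weil1964.ratSp F ((symplecticGram F d f).map (algebraMap F (AdeleRing (𝓞 F) F)))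
        (isUnit_det_symplecticGram_map F f hT)).range :=
  ⟨SpTransport.untransportSp (symplecticGram F d f) hT (ratFrameSp F E σ hσδ hδ hd V b Φ f hΦ₁ hΦ₂ hb hf g₀),
    (frameSp_ratSpToAdelic_eq F E σ hσδ hδ hd V b Φ f hΦ₁ hΦ₂ hb hf hT g₀).symm⟩

/-- conversely **every rational point of the tree comes from `Sp_F(W)`**: for `A ∈ Sp_{2N}(F)`,
`Weil1964.ratSp T_𝐀 A = frameSp (1 ⊗ g₀)` with `g₀ = ratFrame⁻¹ ∘ transportSp T A ∘ ratFrame ∈ Sp_F(W)`.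
[cite: GelbartRogawski1991, §3.1 p. 454 L35–36; Weil1964, Chap. III n° 37 p. 188] -/
theorem exists_frameSp_ratSpToAdelic_eq (hΦ₁ : ∀ (e : E) (x y : V), Φ (e • x) y = e * Φ x y)
    (hΦ₂ : ∀ (e : E) (x y : V), Φ x (e • y) = Φ x y * σ e) (hb : ∀ i j, i ≠ j → Φ (b i) (b j) = 0)
    (hf : ∀ i, Φ (b i) (b i) = algebraMap F E (f i) * δ) (hT : IsUnit (symplecticGram F d f).det)
    (A : Matrix.symplecticGroup (Fin n) F) :
    ∃ g₀ : ratSp F E V Φ,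
      frameSp F E σ hσδ hδ hd V b Φ f hΦ₁ hΦ₂ hb hf (ratSpToAdelic F E V Φ g₀) =
        Weil1964.ratSp F ((symplecticGram F d f).map (algebraMap F (AdeleRing (𝓞 F) F)))
          (isUnit_det_symplecticGram_map F f hT) A := by
  -- the rational symplectic automorphism `g = transportSp T A` of `Fᴺ × Fᴺ`, pulled back to `W = V` by the frame
  set g : symplecticGroup (polar (Matrix.toLinearMap₂' F (symplecticGram F d f))) :=
    SymplecticMatrix.transportSp (symplecticGram F d f) hT A with hg
  let g₀ : V ≃ₗ[F] V :=
    (ratFrame F E σ hσδ hδ hd V b).trans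
      ((g : ((Fin n → F) × (Fin n → F)) ≃ₗ[F] ((Fin n → F) × (Fin n → F))).trans (ratFrame F E σ hσδ hδ hd V b).symm)
  have hconj : ratFrameConj F E σ hσδ hδ hd V b g₀ =
      (g : ((Fin n → F) × (Fin n → F)) ≃ₗ[F] ((Fin n → F) × (Fin n → F))) := by
    refine LinearEquiv.ext fun p => ?_
    simp only [g₀, ratFrameConj, LinearEquiv.trans_apply, LinearEquiv.apply_symm_apply]
  have hg₀ : g₀ ∈ ratSp F E V Φ := by
    rw [mem_ratSp_iff_ratFrameConj_mem F E σ hσδ hδ hd V b Φ f hΦ₁ hΦ₂ hb hf, hconj]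
    exact g.2
  refine ⟨⟨g₀, hg₀⟩, ?_⟩
  have hrat : ratFrameSp F E σ hσδ hδ hd V b Φ f hΦ₁ hΦ₂ hb hf ⟨g₀, hg₀⟩ = g := Subtype.ext hconj
  rw [frameSp_ratSpToAdelic_eq F E σ hσδ hδ hd V b Φ f hΦ₁ hΦ₂ hb hf hT, hrat, hg,
    SpTransport.untransportSp_transportSp]
  rfl

/-- **`frameSp b (Sp_F(W)) = (Weil1964.ratSp F T_𝐀 _).range`** as subgroups of the tree's `Sp(𝐀ᴺ × 𝐀ᴺ, alt (polar β_T))`: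
print's `F`-rational points ARE the tree's `spRat`, in a `Φ`-orthogonal frame.
[cite: GelbartRogawski1991, §3.1 p. 454 L35–36; Weil1964, Chap. III n° 37 p. 188] -/
theorem map_frameSp_range_ratSpToAdelic (hΦ₁ : ∀ (e : E) (x y : V), Φ (e • x) y = e * Φ x y)
    (hΦ₂ : ∀ (e : E) (x y : V), Φ x (e • y) = Φ x y * σ e) (hb : ∀ i j, i ≠ j → Φ (b i) (b j) = 0)
    (hf : ∀ i, Φ (b i) (b i) = algebraMap F E (f i) * δ) (hT : IsUnit (symplecticGram F d f).det) :
    (ratSpToAdelic F E V Φ).range.map (frameSp F E σ hσδ hδ hd V b Φ f hΦ₁ hΦ₂ hb hf : adelicSp F E V Φ →* _) =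
      (Weil1964.ratSp F ((symplecticGram F d f).map (algebraMap F (AdeleRing (𝓞 F) F)))
        (isUnit_det_symplecticGram_map F f hT)).range := by
  ext g'
  constructor
  · rintro ⟨g, ⟨g₀, rfl⟩, rfl⟩
    exact frameSp_ratSpToAdelic_mem_range F E σ hσδ hδ hd V b Φ f hΦ₁ hΦ₂ hb hf hT g₀
  · rintro ⟨A, rfl⟩
    obtain ⟨g₀, hg₀⟩ := exists_frameSp_ratSpToAdelic_eq F E σ hσδ hδ hd V b Φ f hΦ₁ hΦ₂ hb hf hT A
    exact ⟨ratSpToAdelic F E V Φ g₀, ⟨g₀, rfl⟩, hg₀⟩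

/-- **`frameSpRat b : Sp_F(W) (print, inside Sp_𝐀(W)) ≃* spRat (tree)`**, the isomorphism `e₀` of the two "`F`-rational
symplectic groups" lying OVER `frameSp b` (`coe_frameSpRat`) — the input `(e₀, he₀)` of
`SplittingDatum.CompatibleSplitting.transport_of_unique`. [cite: GelbartRogawski1991, §3.1 p. 454 L35–36] -/
def frameSpRat (hΦ₁ : ∀ (e : E) (x y : V), Φ (e • x) y = e * Φ x y)
    (hΦ₂ : ∀ (e : E) (x y : V), Φ x (e • y) = Φ x y * σ e) (hb : ∀ i j, i ≠ j → Φ (b i) (b j) = 0)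
    (hf : ∀ i, Φ (b i) (b i) = algebraMap F E (f i) * δ) (hT : IsUnit (symplecticGram F d f).det) :
    (ratSpToAdelic F E V Φ).range ≃*
      (Weil1964.ratSp F ((symplecticGram F d f).map (algebraMap F (AdeleRing (𝓞 F) F)))
        (isUnit_det_symplecticGram_map F f hT)).range :=
  ((frameSp F E σ hσδ hδ hd V b Φ f hΦ₁ hΦ₂ hb hf).subgroupMap (ratSpToAdelic F E V Φ).range).trans
    (MulEquiv.subgroupCongr (map_frameSp_range_ratSpToAdelic F E σ hσδ hδ hd V b Φ f hΦ₁ hΦ₂ hb hf hT))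

/-- `frameSpRat b` lies over `frameSp b`: `(frameSpRat x : Sp) = frameSp x`. [cite: GelbartRogawski1991, §3.1 p. 454 L35–36] -/
@[simp] theorem coe_frameSpRat (hΦ₁ : ∀ (e : E) (x y : V), Φ (e • x) y = e * Φ x y)
    (hΦ₂ : ∀ (e : E) (x y : V), Φ x (e • y) = Φ x y * σ e) (hb : ∀ i j, i ≠ j → Φ (b i) (b j) = 0)
    (hf : ∀ i, Φ (b i) (b i) = algebraMap F E (f i) * δ) (hT : IsUnit (symplecticGram F d f).det)
    (x : (ratSpToAdelic F E V Φ).range) :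
    ((frameSpRat F E σ hσδ hδ hd V b Φ f hΦ₁ hΦ₂ hb hf hT x :
        (Weil1964.ratSp F ((symplecticGram F d f).map (algebraMap F (AdeleRing (𝓞 F) F)))
          (isUnit_det_symplecticGram_map F f hT)).range) : symplecticGroup (polar (framePairing F d f))) =
      frameSp F E σ hσδ hδ hd V b Φ f hΦ₁ hΦ₂ hb hf (x : adelicSp F E V Φ) := by
  rw [frameSpRat, MulEquiv.trans_apply, MulEquiv.subgroupCongr_apply, MulEquiv.coe_subgroupMap_apply]

/-- … and so does its inverse: `((frameSpRat b)⁻¹ y : Sp_𝐀(W)) = (frameSp b)⁻¹ y`. [cite: GelbartRogawski1991, §3.1 p. 454 L35–36] -/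
@[simp] theorem coe_frameSpRat_symm (hΦ₁ : ∀ (e : E) (x y : V), Φ (e • x) y = e * Φ x y)
    (hΦ₂ : ∀ (e : E) (x y : V), Φ x (e • y) = Φ x y * σ e) (hb : ∀ i j, i ≠ j → Φ (b i) (b j) = 0)
    (hf : ∀ i, Φ (b i) (b i) = algebraMap F E (f i) * δ) (hT : IsUnit (symplecticGram F d f).det)
    (y : (Weil1964.ratSp F ((symplecticGram F d f).map (algebraMap F (AdeleRing (𝓞 F) F)))
      (isUnit_det_symplecticGram_map F f hT)).range) :
    (((frameSpRat F E σ hσδ hδ hd V b Φ f hΦ₁ hΦ₂ hb hf hT).symm y : (ratSpToAdelic F E V Φ).range) : adelicSp F E V Φ) =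
      (frameSp F E σ hσδ hδ hd V b Φ f hΦ₁ hΦ₂ hb hf).symm (y : symplecticGroup (polar (framePairing F d f))) := by
  apply (frameSp F E σ hσδ hδ hd V b Φ f hΦ₁ hΦ₂ hb hf).injective
  rw [MulEquiv.apply_symm_apply, ← coe_frameSpRat F E σ hσδ hδ hd V b Φ f hΦ₁ hΦ₂ hb hf hT, MulEquiv.apply_symm_apply]

end RationalPoints

end Prop311

end Literature.NumberTheory.GelbartRogawski1991

end
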